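import Summits.BirchSwinnertonDyer.BirchSwinnertonDyer.Theorems.ByReductionTypeAtTwoSupersingularFlatCapstoneCore
import Summits.BirchSwinnertonDyer.BirchSwinnertonDyer.Theorems.ByReductionTypeAtTwoSupersingularFlatCapstoneCoprime
import Summits.BirchSwinnertonDyer.BirchSwinnertonDyer.Theorems.ByReductionTypeAtTwoSupersingularFlatZetaPackageSockets
import Summits.BirchSwinnertonDyer.BirchSwinnertonDyer.Theorems.ByReductionTypeAtTwoSupersingularFlatRoad
import HarnessLib

/-!
# Crux `SupersingularRankZeroAtTwo` (K4, item stmt-BirchSwinnertonDyer-19097), line `odd_blind_package` v2.20 (39efd4f3),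
# stub 2/5 `stub_flatPackage : FlatZetaPackageAtTwo` — FILE C3b of hand «hF3-CAP»: THE EXACT DOOR — the f-block of
# `FlatZetaPackageAtTwo` (:1581–1593 VERBATIM) over the displayed print family and the two research residues (H2♭), (B1♭)

Seat `bsd-2adic-t42` GEN 52 (pen GEN 41 SUMMON 20260831T234826Z; director-bsd g27 (1009)(a)/(1010)(a); LEAD ss-1 GEN 26 notes N1–N3).
HONEST FRAMING (D-0054): THEOREMS ONLY — no definition, no named fact, no instance, no notation, no `sorry`.  CONSUMER: no Kato value
is computed, no logarithm unfolded, no modular symbol evaluated; every analytic input is a displayed hypothesis in the tree's exact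
tokens or a tree theorem cited by name.  Capstone helpers toward stub 2; they close NO stub by themselves (stub 2 closes only when the
LEAD's v2.21 glue lands AND its displayed hypotheses are discharged or re-homed); 19097 stays OPEN on its 5 registered stubs
(v2.20 39efd4f3); nothing booked; BSD₂ is proved for no supersingular curve and BSD for no curve by any of this; typed ≠ proved.
`bears_on: K4 (19097) (8) F3 / v2.21`.  Everything here is at `p = 2`.

## What

★★★ `flatZeta_fblock_of_displayed` — at E0b's Sprung–Honda system (model, transport, local variable displayed), for the newform `f`,
`ϖ`, a Sprung pair, the pin `I` (`rank_Λ ≤ 1`, Kato 12.4 (2)), the PINNED localisation `L` and joint Coleman family `J`, (P) Kato's (KZ)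
family at the frame with constant `κK = q ≠ 0`, a cusp family with Kato's guards and the cusp-multiplier law whose multipliers avoid the
height-one primes `∌ 2`, and THE TWO RESIDUES in the socket's currency for the normalisation of record `x δ := C(D δ) • s δ`,
`A δ := C((N·q.num:ℤ))·μ̃ δ`, `d := q.den` — (H2♭) `∀ 𝔭 height-one ∋ C 2, ∃ δ, C((N·q.num:ℤ))·μ̃ δ ∉ 𝔭` and (B1♭) `t : ℤ₂`,
`t = ϖ·q.den` —: LITERALLY the f-block `∃ Z G, (∃ z ∈ Z, (J (L z)).2 = G) ∧ ι G = C ϖ·ι L♭ ∧ (∃ s₀, Z = Λ∙s₀ ∧ ZL2)`.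
ONE call of ★ `SSFlatFold.flatZeta_fblock_of_levelCongruences` on C3a (hE3) and C2 (hcop); `L♭ ≠ 0` by `SSFlatRoad.flat_ne_zero_two`.
Why the residues live at this (inner) level: `q` is the constant of the (KZ) WITNESS at E0b's frame and `μ̃ δ`, `D δ` are the brick's
∃-bound data — they cannot be named in a closed body-level hypothesis without a definition (the LEAD's v2.21 statement question, N3).

References: [Kato2004Asterisque] K. Kato, Astérisque 295 (2004), Thm. 12.4–12.6 (pp. 221–222), Thm. 6.6 (1), Thm. 9.7, Ex. 13.3
(p. 225), §13.9–13.14 (pp. 229–234); [Sprung2012] F. Sprung, J. Number Theory 132 (2012), Thm. 2.2, Def. 3.1, Def. 5.9, Def. 7.1,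
Thm. 7.14, 7.16; [Sprung2017] Thm. 1.12, Cor. 4.4–4.5; [Kobayashi2003] Thm. 6.3, (8.23), Prop. 8.25–8.26; [BlochKato1990] §3
(3.10.1), (3.11); [MazurTateTeitelbaum1986Invent] §I.10, §I.13; [RohrlichInventiones1984] Theorem (p. 409).
-/

set_option autoImplicit false
-- the Theorems namespace of this sub repeats the summit name by design (D-0017 nested layout)
set_option linter.dupNamespace false

noncomputable section

set_option backward.isDefEq.respectTransparency false

open scoped Classical MatrixGroups ModularForm NumberField TensorProduct

namespace Summit.BirchSwinnertonDyer.BirchSwinnertonDyer.Theorems.SSFlatCap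

open CongruenceSubgroup WeierstrassCurve Field IsDedekindDomain NumberField Polynomial
  Literature.NumberTheory.GaloisRepresentations
  Literature.NumberTheory.EllipticCurves Literature.NumberTheory.EllipticCurves.ModularForms
  Literature.NumberTheory.EllipticCurves.Module Literature.NumberTheory.EllipticCurves.Rank1Residual
  Literature.NumberTheory.EllipticCurves.Kobayashi2003 Literature.NumberTheory.EllipticCurves.Kato2004
  Literature.NumberTheory.EllipticCurves.Kato2004.EulerSystemValues Literature.NumberTheory.EllipticCurves.Sprung2012
  Literature.NumberTheory.EllipticCurves.Sprung2017
  Literature.NumberTheory.EllipticCurves.FormalGroupChart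
  ZpExtension
  Summit.BirchSwinnertonDyer.Rank1Residual.Additive Summit.BirchSwinnertonDyer.Rank1Residual.Additive.PadicCyclotomicTower
  Summit.BirchSwinnertonDyer.Rank1Residual.Additive.BallEval
  Summit.BirchSwinnertonDyer.Rank1Residual.F1Sign2
  Summit.BirchSwinnertonDyer.BirchSwinnertonDyer.Theorems.SignedKatoOffTwo.LocalTwo
  Summit.BirchSwinnertonDyer.BirchSwinnertonDyer.Theorems.SignedKatoOffTwo
  Summit.BirchSwinnertonDyer.BirchSwinnertonDyer.Theorems.SignedKatoOffTwo.KatoBK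
  Summit.BirchSwinnertonDyer.BirchSwinnertonDyer.Theorems.SSFlatERL

/-! ## §3 THE EXACT DOOR: the f-block of `FlatZetaPackageAtTwo` over the displayed data and the two research residues (H2♭), (B1♭) -/

section Door

variable (W : WeierstrassCurve ℚ) [W.IsElliptic] [W.IsGloballyMinimal] [ContinuousSMul ℤ_[2] (W.tateModule 2)]
  [Module.Free ℤ_[2] (W.tateModule 2)] [Module.Finite ℤ_[2] (W.tateModule 2)]
  {κ : ZpExtension ℚ 2} (hκ : κ.IsCyclotomic) {γ : Field.absoluteGaloisGroup ℚ} (v : HeightOneSpectrum (𝓞 ℚ))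

omit [W.IsElliptic] [ContinuousSMul ℤ_[2] (W.tateModule 2)] [Module.Free ℤ_[2] (W.tateModule 2)]
  [Module.Finite ℤ_[2] (W.tateModule 2)] in
/-- `N = 3 − a₂ ≠ 0` on the habitat (`a₂ ∈ {0, ±2}`). [folklore] -/
theorem natCast_ne_zero_of_eq_three_sub (hss : GoodSS W 2) {N : ℕ} (hN : (N : ℤ) = 3 - W.frobeniusTrace 2) : (N : ℤ) ≠ 0 := by
  have hap : (2 : ℤ) ∣ W.frobeniusTrace 2 := by exact_mod_cast hss.2
  rcases Summit.BirchSwinnertonDyer.Rank1Residual.Supersingular.frobeniusTrace_two_eq_zero_or W hss.1 hap with h | h | h <;>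
    · rw [hN, h]; norm_num

/-- ★★★ **THE EXACT DOOR: THE f-BLOCK OF `FlatZetaPackageAtTwo` (v2.20 :1581–1593) AT THE SPRUNG–HONDA SYSTEM, OVER THE DISPLAYED
PRINT FAMILY AND THE TWO RESEARCH RESIDUES.**  Displayed, beyond the core (`exists_lifts_levelCongruences_of_katoFamily`): the crux
binders `hγ`, `r_an = 0`; `κK ≠ 0`; `rank_Λ 𝐇¹ ≤ 1` (Kato 12.4 (2), `Kato2004.thm12_4`); the f-block's `ϖ`, Sprung pair and PINNED joint
Coleman family `J`; the cusp multipliers avoiding the height-one primes `∌ 2` (`hμ`, brick B1); and — THE TWO RESIDUES in the socket's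
currency for the normalisation of record — (H2♭) `h2 : ∀ 𝔭 height-one, C 2 ∈ 𝔭 → ∃ δ, C((N·q.num:ℤ))·μ̃ δ ∉ 𝔭` and (B1♭)
`(t : ℤ_[2]) (ht : t = ϖ·q.den)`.  Conclusion: LITERALLY the f-block
`∃ Z G, (∃ z ∈ Z, (J (L z)).2 = G) ∧ ι G = C ϖ · ι L♭ ∧ (∃ s₀, Z = Λ∙s₀ ∧ ZL2)`.  ONE call of ★ `SSFlatFold.flatZeta_fblock_of_levelCongruences`
on §2 (hE3) and C2 (hcop); `L♭ ≠ 0` by `SSFlatRoad.flat_ne_zero_two`.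
[cite: Kato2004Asterisque, Thm. 12.4 (2), Thm. 12.5 (1)(4), Thm. 12.6 (pp. 221–222), §13.9, §13.12–13.14 (pp. 230–234)]
[cite: Sprung2012, Thm. 2.2, Def. 7.1 (p. 1500), Thm. 7.14, 7.16] [cite: Sprung2017, Thm. 1.12, Cor. 4.4–4.5] [cite: Kobayashi2003, Thm. 6.3, (8.23)] -/
theorem flatZeta_fblock_of_displayed (hss : GoodSS W 2)
    -- E0b's frame and model data
    (Φ : AlgebraicClosure ℚ_[2] ≃ₐ[ℚ] AlgebraicClosure (v.adicCompletion ℚ)) (ι : AlgebraicClosure ℚ →ₐ[ℚ] AlgebraicClosure ℚ_[2])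
    {x : ℕ → ℚ_[2]} {y : ℕ → localPoints W ℚ_[2]} {σ : ℕ → Field.absoluteGaloisGroup ℚ_[2]} {d₀ : ℕ → localPoints W ℚ_[2]} {N : ℕ}
    (hx0 : x 0 = 1) (hx1 : (2 : ℚ_[2]) * x 1 = W.frobeniusTrace 2)
    (hx2 : (2 : ℚ_[2]) * x 2 = W.frobeniusTrace 2 * x 1 - x 0) (hN : (N : ℤ) = 3 - W.frobeniusTrace 2)
    (hyΩ : haveI := isIntegral_genFib_baseChange 2 ((integralModelInt W).map (Int.castRingHom ℤ_[2]))
        ∀ m, (toLoc ((genFibΩ_eq_baseChange ((integralModelInt W).map (Int.castRingHom ℤ_[2]))).trans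
              (baseChange_twoAdicModel W))).symm (y m) ∈
            subfieldPoints (genFibΩ 2 ((integralModelInt W).map (Int.castRingHom ℤ_[2]))) (layer 2 m).toSubfield
              coeffs_mem_layer ∧
          (toLoc ((genFibΩ_eq_baseChange ((integralModelInt W).map (Int.castRingHom ℤ_[2]))).trans
              (baseChange_twoAdicModel W))).symm (y m) ∈
            kernel (Valued.v (R := PadicAlgCl 2)) (genFibΩ 2 ((integralModelInt W).map (Int.castRingHom ℤ_[2]))) ∧
          ptLogΩ 2 ((integralModelInt W).map (Int.castRingHom ℤ_[2]))
            ((toLoc ((genFibΩ_eq_baseChange ((integralModelInt W).map (Int.castRingHom ℤ_[2]))).trans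
              (baseChange_twoAdicModel W))).symm (y m)) =
            ∑ k ∈ Finset.range m, algebraMap ℚ_[2] (PadicAlgCl 2) (x k) * (zeta 2 (m - k) - 1))
    (hystab : ∀ m, ∀ τ ∈ stab 2 m, τ • y m = y m)
    (hσ : ∀ m, 1 ≤ m → σ m • zeta 2 m = (zeta 2 m)⁻¹)
    (hd₀ : ∀ n, d₀ n = N • (y (n + 2) + σ (n + 2) • y (n + 2)) - 2 • y 1)
    (hL₀ : ∀ m, d₀ m ∈ localLayerPointsOfEmb κ ι W m)
    -- the transport of the system to `ℚ_v`
    {c : ℕ → localPoints W (v.adicCompletion ℚ)}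
    (hc : ∀ m, c m = WeierstrassCurve.Affine.Point.map (W' := W)
        (Φ : AlgebraicClosure ℚ_[2] →ₐ[ℚ] AlgebraicClosure (v.adicCompletion ℚ))
        (show (W.baseChange (AlgebraicClosure ℚ_[2])).toAffine.Point from d₀ m))
    (hcL : ∀ m, c m ∈ localLayerPointsOfEmb κ (closureEmb (K := ℚ) (v.adicCompletion ℚ)) W m)
    (hTR : ∀ n, localTraceOfEmb κ (closureEmb (K := ℚ) (v.adicCompletion ℚ)) W (n + 1) (n + 2) (c (n + 2)) =
      W.frobeniusTrace 2 • c (n + 1) - c n)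
    -- the local variable on the model, its lift `g₁`, and the f-block's lift `g`
    {g₀ : Field.absoluteGaloisGroup ℚ_[2]} (hg₀ : ∀ m j : ℕ, g₀ ^ j • zeta 2 m = zeta 2 m ^ 5 ^ j)
    {g₁ g : Field.absoluteGaloisGroup (v.adicCompletion ℚ)}
    (hg₁ : κ.IsTopGenerator (resGalOfEmb (closureEmb (K := ℚ) (v.adicCompletion ℚ)) g₁))
    (hg : κ.IsTopGenerator (resGalOfEmb (closureEmb (K := ℚ) (v.adicCompletion ℚ)) g))
    (hTg : ∀ (j : ℕ) (P : localPoints W ℚ_[2]),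
        (show localPoints W (v.adicCompletion ℚ) from
          WeierstrassCurve.Affine.Point.map (W' := W)
            (Φ : AlgebraicClosure ℚ_[2] →ₐ[ℚ] AlgebraicClosure (v.adicCompletion ℚ))
            (show (W.baseChange (AlgebraicClosure ℚ_[2])).toAffine.Point from (g₀ ^ j • P))) =
          g₁ ^ j • (show localPoints W (v.adicCompletion ℚ) from
            WeierstrassCurve.Affine.Point.map (W' := W)
              (Φ : AlgebraicClosure ℚ_[2] →ₐ[ℚ] AlgebraicClosure (v.adicCompletion ℚ))
              (show (W.baseChange (AlgebraicClosure ℚ_[2])).toAffine.Point from P)))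
    -- the newform, the pin, the pinned localisation
    [NeZero (W.conductorNorm ℤ)] (f : CuspForm (Gamma0 (W.conductorNorm ℤ)) 2) (hf : IsNewformOf W f)
    (I : Kato2004.IwasawaH1Data W 2 κ γ)
    (L : letI := moduleOfGenerator κ (closureEmb (K := ℚ) (v.adicCompletion ℚ)) W hg
      I.H →ₗ[IwasawaAlgebra 2] (localTowerPointsOfEmb κ (closureEmb (K := ℚ) (v.adicCompletion ℚ)) W →+ ℤ_[2]))
    (hLpin : ∀ (x : I.H) (n k : ℕ) (Q : localPoints W (v.adicCompletion ℚ))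
        (hQ : Q ∈ localLayerPointsOfEmb κ (closureEmb (K := ℚ) (v.adicCompletion ℚ)) W n),
        PadicInt.toZModPow k (L x ⟨Q, localLayerPointsOfEmb_le_localTowerPointsOfEmb κ _ W n hQ⟩) =
          CyclotomicLayer.tatePairingPk W κ v n k (I.proj n x) ⟨Q, hQ⟩)
    -- the frames
    (e : ∀ k : ℕ, CyclotomicField (cycLevel 2 k ∅) ℚ →ₐ[ℚ] PadicAlgCl 2)
    (he : ∀ k, e k (IsCyclotomicExtension.zeta (cycLevel 2 k ∅) ℚ (CyclotomicField (cycLevel 2 k ∅) ℚ)) = zeta 2 k)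
    (τ : ∀ m : ℕ, ZMod (2 ^ m) → Field.absoluteGaloisGroup ℚ_[2])
    (hτ : ∀ (m : ℕ) (a : ZMod (2 ^ m)), IsUnit a → τ m a • zeta 2 m = zeta 2 m ^ a.val)
    (ιC : (m : ℕ) → (CyclotomicField m ℚ →+* ℂ))
    (hιC : ∀ k : ℕ, ιC (cycLevel 2 k ∅) (IsCyclotomicExtension.zeta (cycLevel 2 k ∅) ℚ (CyclotomicField (cycLevel 2 k ∅) ℚ)) =
      Complex.exp (2 * Real.pi * Complex.I / (cycLevel 2 k ∅ : ℕ)))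
    -- (P) Kato's (KZ) family at this frame, with its constant
    {κK : ℝ} {q : ℚ} (hq : κK = q)
    (ΛK : ∀ (k : ℕ) (r : Finset (HeightOneSpectrum (𝓞 ℚ))),
      H1 (tateRep W 2) (cycSubgroup 2 k r) →ₗ[ℤ_[2]] ℚ_[2] ⊗[ℚ] CyclotomicField (cycLevel 2 k r) ℚ)
    (hfam : ∀ (c d a : ℤ) (A : ℕ), 0 < A → Int.gcd c (6 * 2 * A) = 1 → Int.gcd d (6 * 2 * W.conductorNorm ℤ) = 1 →
      ∃ (z : ∀ (k : ℕ) (r : (cyclotomicLevelsRat 2 (badPlaces c d A (W.conductorNorm ℤ))).Ideals),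
            H1 (tateRep W 2) ((cyclotomicLevelsRat 2 (badPlaces c d A (W.conductorNorm ℤ))).level k r.1))
        (x : ∀ (k : ℕ) (r : (cyclotomicLevelsRat 2 (badPlaces c d A (W.conductorNorm ℤ))).Ideals),
            CyclotomicField (cycLevel 2 k r.1) ℚ),
        ZetaBody W 2 f ιC κK ΛK c d a A z x ∧
        ∀ (n : ℕ) (Q₀ : localPoints W ℚ_[2])
          (hQv : WeierstrassCurve.Affine.Point.map (W' := W)
              (Φ : AlgebraicClosure ℚ_[2] →ₐ[ℚ] AlgebraicClosure (v.adicCompletion ℚ))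
              (show (W.baseChange (AlgebraicClosure ℚ_[2])).toAffine.Point from Q₀) ∈
            localLayerPointsOfEmb κ (closureEmb (K := ℚ) (v.adicCompletion ℚ)) W n),
          (∀ (X Y : AlgebraicClosure ℚ_[2]) (hXY : (W.baseChange (AlgebraicClosure ℚ_[2])).toAffine.Nonsingular X Y),
              (show (W.baseChange (AlgebraicClosure ℚ_[2])).toAffine.Point from Q₀) = .some X Y hXY → 1 < Valued.v X) →
          ∃ t : ℤ_[2],
            (∀ k : ℕ, CyclotomicLayer.tatePairingPk W κ v n k
                (levelToLayerTwo W hκ (∅ : Set (HeightOneSpectrum (𝓞 ℚ))) n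
                  (z (n + 2) (cyclotomicLevelsRat 2 (badPlaces c d A (W.conductorNorm ℤ))).idealOne))
                ⟨_, hQv⟩ = PadicInt.toZModPow k t) ∧
            algebraMap ℚ_[2] (PadicAlgCl 2) (t : ℚ_[2]) =
              ∑ b : (ZMod (2 ^ (n + 2)))ˣ, τ (n + 2) (b : ZMod (2 ^ (n + 2))) •
                ((∑' i : ℕ, algebraMap ℚ_[2] (PadicAlgCl 2) (PowerSeries.coeff i (W.map (algebraMap ℚ ℚ_[2])).formalLog) *
                    (WeierstrassCurve.Affine.Point.zCoord
                      (show (W.baseChange (AlgebraicClosure ℚ_[2])).toAffine.Point from Q₀)) ^ i) *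
                  e (n + 2) (x (n + 2) (cyclotomicLevelsRat 2 (badPlaces c d A (W.conductorNorm ℤ))).idealOne)))
    -- the cusp family
    {Δ : Type*} (cδ dδ aδ : Δ → ℤ) (eeδ : Δ → ℕ) (dδ' Dδ : Δ → ℤ) (μt : Δ → IwasawaAlgebra 2)
    (hgc : ∀ δ, Int.gcd (cδ δ) (6 * 2 * 2 ^ eeδ δ) = 1) (hgd : ∀ δ, Int.gcd (dδ δ) (6 * 2 * W.conductorNorm ℤ) = 1)
    (hdd' : ∀ δ, dδ δ * dδ' δ ≡ 1 [ZMOD ((2 ^ eeδ δ : ℕ) : ℤ)])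
    (hμt : ∀ (δ : Δ) (n : ℕ) (χ : DirichletCharacter ℂ_[2] (2 ^ (n + 2))), χ.Even → (∃ j : ℕ, orderOf χ = 2 ^ j) →
      HasSum (fun k ↦ ((algebraMap ℚ_[2] ℂ_[2]).comp (algebraMap ℤ_[2] ℚ_[2])) (PowerSeries.coeff k (μt δ)) *
          (χ (5 : ZMod (2 ^ (n + 2))) - 1) ^ k)
        ((Dδ δ : ℂ_[2]) * ((cδ δ : ℂ_[2]) ^ 2 * (dδ δ : ℂ_[2]) ^ 2 *
            ((ratMinusSymbol f ((aδ δ : ℚ) / (2 ^ eeδ δ : ℕ)) : ℚ) : ℂ_[2])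
          - (cδ δ : ℂ_[2]) * (dδ δ : ℂ_[2]) ^ 2 * χ (cδ δ : ZMod (2 ^ (n + 2))) *
              ((ratMinusSymbol f ((aδ δ * cδ δ : ℚ) / (2 ^ eeδ δ : ℕ)) : ℚ) : ℂ_[2])
          - (cδ δ : ℂ_[2]) ^ 2 * (dδ δ : ℂ_[2]) * χ (dδ δ : ZMod (2 ^ (n + 2))) *
              ((ratMinusSymbol f ((aδ δ * dδ' δ : ℚ) / (2 ^ eeδ δ : ℕ)) : ℚ) : ℂ_[2])
          + (cδ δ : ℂ_[2]) * (dδ δ : ℂ_[2]) * (χ (cδ δ : ZMod (2 ^ (n + 2))) * χ (dδ δ : ZMod (2 ^ (n + 2)))) *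
              ((ratMinusSymbol f ((aδ δ * cδ δ * dδ' δ : ℚ) / (2 ^ eeδ δ : ℕ)) : ℚ) : ℂ_[2]))))
    -- the remaining f-block binders and the crux binders the socket consumes
    (hγ : κ.IsTopGenerator γ) (hr : W.analyticRank = 0) (hκK : κK ≠ 0)
    (hrank : Module.rank (IwasawaAlgebra 2) I.H ≤ 1) (ϖ : ℚ) (Ls Lf : IwasawaAlgebra 2)
    (hSP : IsSprungPair f 2 (W.frobeniusTrace 2) Ls Lf)
    (J : letI := moduleOfGenerator κ (closureEmb (K := ℚ) (v.adicCompletion ℚ)) W hg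
      (localTowerPointsOfEmb κ (closureEmb (K := ℚ) (v.adicCompletion ℚ)) W →+ ℤ_[2]) →ₗ[IwasawaAlgebra 2]
        IwasawaAlgebra 2 × IwasawaAlgebra 2)
    (hJ : ∀ w, IsColemanPair κ (closureEmb (K := ℚ) (v.adicCompletion ℚ)) W (W.frobeniusTrace 2) g c w (J w).1 (J w).2)
    -- the cusp multipliers avoid every height-one prime away from `2` (brick B1)
    (hμ : ∀ 𝔭 : PrimeSpectrum (IwasawaAlgebra 2), 𝔭.asIdeal.height = 1 →
      PowerSeries.C (2 : ℤ_[2]) ∉ 𝔭.asIdeal → ∃ δ, μt δ ∉ 𝔭.asIdeal)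
    -- (H2♭) and (B1♭): the two research residues, in the socket's currency
    (h2 : ∀ 𝔭 : PrimeSpectrum (IwasawaAlgebra 2), 𝔭.asIdeal.height = 1 →
      PowerSeries.C (2 : ℤ_[2]) ∈ 𝔭.asIdeal → ∃ δ, PowerSeries.C ((((N : ℤ) * q.num : ℤ) : ℤ_[2])) * μt δ ∉ 𝔭.asIdeal)
    (t : ℤ_[2]) (ht : (t : ℚ_[2]) = (ϖ : ℚ_[2]) * (((q.den : ℤ) : ℤ_[2]) : ℚ_[2])) :
    ∃ (Z : Submodule (IwasawaAlgebra 2) I.H) (G : IwasawaAlgebra 2),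
      (∃ z ∈ Z, (J (L z)).2 = G) ∧
      iwasawaToPowerSeries 2 G = PowerSeries.C (ϖ : ℚ_[2]) * iwasawaToPowerSeries 2 Lf ∧
      (∃ s₀ : I.H, Z = Submodule.span (IwasawaAlgebra 2) {s₀} ∧
        ∀ 𝔭 : PrimeSpectrum (IwasawaAlgebra 2), 𝔭.asIdeal.height = 1 →
          PowerSeries.C (2 : ℤ_[2]) ∉ 𝔭.asIdeal →
          ∃ (M : IwasawaAlgebra 2) (s : I.H), M ∉ 𝔭.asIdeal ∧
            Literature.NumberTheory.EllipticCurves.Kato2004.IsEulerSystemClassTwo W hκ I s ∧ s ≠ 0 ∧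
            M • s₀ = s) := by
  letI := moduleOfGenerator κ (closureEmb (K := ℚ) (v.adicCompletion ℚ)) W hg
  obtain ⟨s, hES, hE3⟩ := exists_lifts_levelCongruences_of_katoFamily W hκ v hss Φ ι hx0 hx1 hx2 hN hyΩ hystab hσ hd₀ hL₀ hc hcL
    hTR hg₀ hg₁ hg hTg f hf I L hLpin e he τ hτ ιC hιC hq ΛK hfam cδ dδ aδ eeδ dδ' Dδ μt hgc hgd hdd' hμt
  have hap : (2 : ℤ) ∣ W.frobeniusTrace 2 := by exact_mod_cast hss.2
  have hq0 : q ≠ 0 := by rintro rfl; exact hκK (by exact_mod_cast hq)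
  have hNq : ((N : ℤ) * q.num : ℤ) ≠ 0 := mul_ne_zero (natCast_ne_zero_of_eq_three_sub W hss hN) (Rat.num_ne_zero.mpr hq0)
  have hLf : Lf ≠ 0 := SSFlatRoad.flat_ne_zero_two W hf hss.1 hap
    ((WeierstrassCurve.analyticRank_eq_zero_iff_holds (W := W) hf.hasEntireLFunction).mp hr) hSP
  have hd : ((q.den : ℤ) : ℤ_[2]) ≠ 0 := by exact_mod_cast q.den_ne_zero
  have hcop := hcop_of_cuspFamily W hκ (closureEmb (K := ℚ) (v.adicCompletion ℚ)) hg hap I L J hJ f hSP hLf s hES Dδ μt hNq hμ hE3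
  exact SSFlatFold.flatZeta_fblock_of_levelCongruences W v hss hκ hγ hg hap I hrank L J hJ f ϖ Ls Lf hSP hLf
    (fun δ ↦ (PowerSeries.C ((Dδ δ : ℤ) : ℤ_[2]) : IwasawaAlgebra 2) • s δ)
    (fun δ ↦ PowerSeries.C ((((N : ℤ) * q.num : ℤ) : ℤ_[2])) * μt δ) hd hE3 hcop h2 t ht

end Door

end Summit.BirchSwinnertonDyer.BirchSwinnertonDyer.Theorems.SSFlatCap

end
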